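import Summits.Ventures.HodgeRepro.Tier3PinningGlue
import Summits.Ventures.HodgeRepro.Tier3RootsOfUnityEval
import Summits.Ventures.HodgeRepro.Tier3PadicComplexInt

/-!
# Tier 3, T3.2 — (R2) ∧ (R1): the pinning chain with the L-VALUES in the FIELD (the transfer joint of E3)
(seat t3-p3, gen 12)

Blind re-derivation cell `pub-hodge-repro`, Tier-3 seat `t3-p3` (route/TIER3.md §6; proofs/t3-p3/R2-PINNING-ADDENDUM-5.md
§A29 (E3)).  The kernel glue `four_line_pinning_of_interpolation` (Tier3PinningGlue) takes its interpolated values `L ν`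
and its non-zero factors `u ν` INSIDE the value ring `B` of the Weierstrass argument — on the paper side `B = 𝓞_{ℂ_p}` and
`L ν` is the MEASURE VALUE `m_j(ν) = ∫ χ̂_j′ ν̂ dℒ ∈ 𝓞_{ℂ_p}` (E2 / E3).  The printed interpolation formula (Hsieh 2014
Prop 4.9 read at `χ_j′ν`, ADDENDUM-4 §A20 (6)) relates that measure value to the `L`-value in the FIELD `ℂ_p` (through the
fixed embedding `ι_p`):

  `m_j(ν) = C_j · Eul(χ_w) · L(0, χ_j′ν)`   with `C_j · Eul(χ_w)` finite, non-zero and NOT `p`-integral in general (P1′),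

so the `L`-value itself is not an element of `𝓞_{ℂ_p}` and cannot be the glue's `L ν`; until now the passage «the glue's
cofinite conclusion for `m_j` is the cofinite conclusion for `L(1, λ_jν)`, and `h0` for `m_j` is R-B for the `L`-values» was a
CELL sentence on paper (ADDENDUM-5 (E3)).  This file is its kernel twin:

* `ValueTransfer.eq_zero_iff_of_map_eq_mul` — in a domain, `ι m = c · v` with `c ≠ 0` and `ι` injective gives
  `m = 0 ↔ v = 0`;
* `ValueTransfer.setOf_ne_zero_eq` / `ValueTransfer.exists_ne_zero_iff` — the good sets and the one-value hypotheses of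
  the two readings coincide;
* `cofinite_good_of_interpolation_transfer` / `four_line_pinning_of_interpolation_transfer` — the glue restated with the
  values `v j ν` in any domain `F` receiving `B` injectively, the relation `ι (m j ν) = c j ν * v j ν` with non-zero
  constants `c j ν ∈ F` (ν-dependent, not assumed integral or unital), and R-B stated on the `v`'s;
* `four_line_pinning_padicComplex_transfer` — the instance `B = 𝓞_ℂ_[p] ⊂ F = ℂ_[p]` in the finite-order form of
  `four_line_pinning_of_rootsOfUnity` (`Ξ ≅ μ_{p^∞}`, `ζ ν` a `p`-power root of unity).

HONESTY.  Every analytic / arithmetic input is a HYPOTHESIS here — the interpolation formula `hm`, the relation `hrel`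
between measure value and `L`-value with its non-vanishing constants (Lemma E and the Gauss-sum / Euler factors of
§A20 (5)), ONE non-vanishing `L`-value per line (`h0` = TIER3.md's R-B, NOT closed in print) and the sign cofiniteness `hε`;
nothing about Hecke characters, measures or `L`-functions is proved.  Nothing here says anything about the status of the
Hodge conjecture for CM abelian varieties, which is NOT proved.
-/

set_option autoImplicit false

namespace Summit.Ventures.HodgeRepro.T3.R2Pinning

open PowerSeries

namespace ValueTransfer

variable {B F : Type*} [CommRing B] [CommRing F] [IsDomain F]

/-- **The transfer joint.** If `ι : B →+* F` is injective, `c ≠ 0` in the domain `F` and `ι m = c * v`, then `m` vanishes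
iff `v` does. -/
theorem eq_zero_iff_of_map_eq_mul (ι : B →+* F) (hι : Function.Injective ι) {m : B} {c v : F} (hc : c ≠ 0)
    (h : ι m = c * v) : m = 0 ↔ v = 0 := by
  constructor
  · intro hm
    rw [hm, map_zero] at h
    exact (mul_eq_zero.mp h.symm).resolve_left hc
  · intro hv
    rw [hv, mul_zero] at h
    exact hι (by rw [h, map_zero])

/-- The non-vanishing sets of the two readings coincide. -/
theorem setOf_ne_zero_eq {Ξ : Type*} (ι : B →+* F) (hι : Function.Injective ι) (m : Ξ → B) (c v : Ξ → F)
    (hc : ∀ ν, c ν ≠ 0) (h : ∀ ν, ι (m ν) = c ν * v ν) : {ν | v ν ≠ 0} = {ν | m ν ≠ 0} := by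
  ext ν
  simp only [Set.mem_setOf_eq, ne_eq]
  exact not_congr (eq_zero_iff_of_map_eq_mul ι hι (hc ν) (h ν)).symm

/-- ONE non-vanishing value in either reading gives one in the other. -/
theorem exists_ne_zero_iff {Ξ : Type*} (ι : B →+* F) (hι : Function.Injective ι) (m : Ξ → B) (c v : Ξ → F)
    (hc : ∀ ν, c ν ≠ 0) (h : ∀ ν, ι (m ν) = c ν * v ν) : (∃ ν₀, v ν₀ ≠ 0) ↔ ∃ ν₀, m ν₀ ≠ 0 := by
  constructor <;> rintro ⟨ν₀, hν₀⟩ <;> refine ⟨ν₀, ?_⟩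
  · exact fun hm => hν₀ ((eq_zero_iff_of_map_eq_mul ι hι (hc ν₀) (h ν₀)).mp hm)
  · exact fun hv => hν₀ ((eq_zero_iff_of_map_eq_mul ι hι (hc ν₀) (h ν₀)).mpr hv)

/-- The good set of one reading is the good set of the other (with the same sign condition). -/
theorem setOf_good_eq {Ξ : Type*} (ι : B →+* F) (hι : Function.Injective ι) (m : Ξ → B) (c v : Ξ → F)
    (hc : ∀ ν, c ν ≠ 0) (h : ∀ ν, ι (m ν) = c ν * v ν) (ε : Ξ → ℤˣ) :
    {ν | v ν ≠ 0 ∧ ε ν = 1} = {ν | m ν ≠ 0 ∧ ε ν = 1} := by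
  ext ν
  simp only [Set.mem_setOf_eq, ne_eq]
  exact and_congr_left fun _ => not_congr (eq_zero_iff_of_map_eq_mul ι hι (hc ν) (h ν)).symm

end ValueTransfer

section Glue

variable {A : Type*} [CommRing A] [IsDomain A] [IsDiscreteValuationRing A]
  [IsAdicComplete (IsLocalRing.maximalIdeal A) A] [UniformSpace A] [IsUniformAddGroup A]
  [IsTopologicalRing A]
variable {B : Type*} [CommRing B] [IsDomain B] [UniformSpace B] [IsUniformAddGroup B] [T2Space B]
  [CompleteSpace B] [IsTopologicalRing B] [IsLinearTopology B B] [Algebra A B] [ContinuousSMul A B]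
variable {F : Type*} [CommRing F] [IsDomain F]
variable {Ξ : Type*}

/-- **One line, values in the field.** The measure values `m ν ∈ B` satisfy the interpolation formula
`m ν = u ν · G(ζ ν − 1)`; the `L`-values `v ν ∈ F` are related to them by `ι (m ν) = c ν · v ν` with non-zero constants
`c ν ∈ F` (the `C_j · Eul(χ_w)` of §A20 (6), not assumed integral); ONE non-vanishing `L`-value and finitely many bad
signs: then `{ν | v ν ≠ 0 ∧ ε ν = 1}` is cofinite. -/
theorem cofinite_good_of_interpolation_transfer (hinj : Function.Injective (algebraMap A B))
    (ζ : Ξ → B) (hζ : Function.Injective ζ) (hev : ∀ ν, HasEval (ζ ν - 1)) (G : PowerSeries A)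
    (m u : Ξ → B) (hu : ∀ ν, u ν ≠ 0) (hm : ∀ ν, m ν = u ν * aeval (hev ν) G)
    (ι : B →+* F) (hι : Function.Injective ι) (c v : Ξ → F) (hc : ∀ ν, c ν ≠ 0)
    (hrel : ∀ ν, ι (m ν) = c ν * v ν) (h0 : ∃ ν₀, v ν₀ ≠ 0)
    (ε : Ξ → ℤˣ) (hε : {ν | ε ν ≠ 1}.Finite) :
    {ν | v ν ≠ 0 ∧ ε ν = 1}ᶜ.Finite := by
  rw [ValueTransfer.setOf_good_eq ι hι m c v hc hrel ε]
  exact cofinite_good_of_interpolation (B := B) hinj ζ hζ hev G m u hu hm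
    ((ValueTransfer.exists_ne_zero_iff ι hι m c v hc hrel).mp h0) ε hε

/-- **Finitely many lines, values in the field.** -/
theorem infinite_common_good_of_interpolation_transfer [Infinite Ξ] {ι' : Type*} [Finite ι']
    (hinj : Function.Injective (algebraMap A B))
    (ζ : Ξ → B) (hζ : Function.Injective ζ) (hev : ∀ ν, HasEval (ζ ν - 1)) (G : ι' → PowerSeries A)
    (m u : ι' → Ξ → B) (hu : ∀ j ν, u j ν ≠ 0) (hm : ∀ j ν, m j ν = u j ν * aeval (hev ν) (G j))
    (ι : B →+* F) (hι : Function.Injective ι) (c v : ι' → Ξ → F) (hc : ∀ j ν, c j ν ≠ 0)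
    (hrel : ∀ j ν, ι (m j ν) = c j ν * v j ν) (h0 : ∀ j, ∃ ν₀, v j ν₀ ≠ 0)
    (ε : ι' → Ξ → ℤˣ) (hε : ∀ j, {ν | ε j ν ≠ 1}.Finite) :
    {ν : Ξ | ∀ j, v j ν ≠ 0 ∧ ε j ν = 1}.Infinite := by
  have h := infinite_iInter_of_cofinite (fun j => {ν : Ξ | v j ν ≠ 0 ∧ ε j ν = 1}) fun j =>
    cofinite_good_of_interpolation_transfer (B := B) hinj ζ hζ hev (G j) (m j) (u j) (hu j) (hm j)
      ι hι (c j) (v j) (hc j) (hrel j) (h0 j) (ε j) (hε j)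
  convert h using 1
  ext ν
  simp

/-- **The face, values in the field (ADDENDUM-5 (E3) on the kernel).** Four lines over the infinite commutative group
`Ξ`: interpolation data for the measure values `m j ν ∈ B`, the relation `ι (m j ν) = c j ν · v j ν` to the `L`-values
`v j ν ∈ F` with non-zero constants, ONE non-vanishing `L`-value per line (R-B as TIER3.md states it), finitely many bad
signs per line.  Then infinitely many `ν` make all four `L`-values non-zero with all four root numbers `+1`, and the
constant twist vector satisfies N2. -/
theorem four_line_pinning_of_interpolation_transfer [Infinite Ξ] [CommGroup Ξ]
    (hinj : Function.Injective (algebraMap A B))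
    (ζ : Ξ → B) (hζ : Function.Injective ζ) (hev : ∀ ν, HasEval (ζ ν - 1)) (G : Fin 4 → PowerSeries A)
    (m u : Fin 4 → Ξ → B) (hu : ∀ j ν, u j ν ≠ 0) (hm : ∀ j ν, m j ν = u j ν * aeval (hev ν) (G j))
    (ι : B →+* F) (hι : Function.Injective ι) (c v : Fin 4 → Ξ → F) (hc : ∀ j ν, c j ν ≠ 0)
    (hrel : ∀ j ν, ι (m j ν) = c j ν * v j ν) (h0 : ∀ j, ∃ ν₀, v j ν₀ ≠ 0)
    (ε : Fin 4 → Ξ → ℤˣ) (hε : ∀ j, {ν | ε j ν ≠ 1}.Finite) :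
    {ν : Ξ | ∀ j, v j ν ≠ 0 ∧ ε j ν = 1}.Infinite ∧
      ∀ ν ∈ {ν : Ξ | ∀ j, v j ν ≠ 0 ∧ ε j ν = 1}, ∀ η : Fin 4 → Ξ, (∀ j, η j = ν) →
        η 0 * η 1 = η 2 * η 3 :=
  ⟨infinite_common_good_of_interpolation_transfer (B := B) hinj ζ hζ hev G m u hu hm ι hι c v hc hrel h0 ε hε,
    fun ν _ η hη => by rw [hη 0, hη 1, hη 2, hη 3]⟩

end Glue

section PadicInstance

variable {p : ℕ} [Fact p.Prime]
variable {A : Type*} [CommRing A] [IsDomain A] [IsDiscreteValuationRing A]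
  [IsAdicComplete (IsLocalRing.maximalIdeal A) A] [UniformSpace A] [IsUniformAddGroup A]
  [IsTopologicalRing A] [Algebra A 𝓞_ℂ_[p]] [ContinuousSMul A 𝓞_ℂ_[p]]
variable {Ξ : Type*}

/-- **The face on `𝓞_ℂ_[p] ⊂ ℂ_[p]`, finite-order twists.** The measure values `m j ν ∈ 𝓞_ℂ_[p]` interpolate at the
`p`-power roots of unity `ζ ν − 1` (`four_line_pinning_of_rootsOfUnity` at `B = 𝓞_ℂ_[p]`, `p` topologically nilpotent by
Tier3PadicComplexInt); the `L`-values `v j ν ∈ ℂ_[p]` satisfy `(m j ν : ℂ_[p]) = c j ν * v j ν` with non-zero constants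
`c j ν ∈ ℂ_[p]`; ONE non-vanishing `L`-value per line; finitely many bad signs per line. -/
theorem four_line_pinning_padicComplex_transfer [Infinite Ξ] [CommGroup Ξ]
    (hinj : Function.Injective (algebraMap A 𝓞_ℂ_[p]))
    (ζ : Ξ → 𝓞_ℂ_[p]) (hζ : Function.Injective ζ) (n : Ξ → ℕ) (hroot : ∀ ν, ζ ν ^ p ^ n ν = 1)
    (G : Fin 4 → PowerSeries A) (m u : Fin 4 → Ξ → 𝓞_ℂ_[p]) (hu : ∀ j ν, u j ν ≠ 0)
    (hm : ∀ j ν, m j ν = u j ν * aeval (hasEval_sub_one_of_pow_prime_pow_eq_one (Fact.out : p.Prime)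
      (isTopologicallyNilpotent_natCast_prime p) (hroot ν)) (G j))
    (c v : Fin 4 → Ξ → ℂ_[p]) (hc : ∀ j ν, c j ν ≠ 0) (hrel : ∀ j ν, ((m j ν : 𝓞_ℂ_[p]) : ℂ_[p]) = c j ν * v j ν)
    (h0 : ∀ j, ∃ ν₀, v j ν₀ ≠ 0) (ε : Fin 4 → Ξ → ℤˣ) (hε : ∀ j, {ν | ε j ν ≠ 1}.Finite) :
    {ν : Ξ | ∀ j, v j ν ≠ 0 ∧ ε j ν = 1}.Infinite ∧
      ∀ ν ∈ {ν : Ξ | ∀ j, v j ν ≠ 0 ∧ ε j ν = 1}, ∀ η : Fin 4 → Ξ, (∀ j, η j = ν) →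
        η 0 * η 1 = η 2 * η 3 :=
  four_line_pinning_of_interpolation_transfer (B := 𝓞_ℂ_[p]) hinj ζ hζ
    (fun ν => hasEval_sub_one_of_pow_prime_pow_eq_one (Fact.out : p.Prime)
      (isTopologicallyNilpotent_natCast_prime p) (hroot ν)) G m u hu hm
    (𝓞_ℂ_[p]).subtype (ValuationSubring.subtype_injective _) c v hc hrel h0 ε hε

end PadicInstance

end Summit.Ventures.HodgeRepro.T3.R2Pinning
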